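import Literature.Computability.Complexity.HardcoreInapproximabilityMWWRate
import Literature.Analysis.SpecialFunctions.LogChooseStirling
import HarnessLib

/-!
# The colour factor of the second-moment ratio: entropy form and Stirling bounds

In the ε-form (`pairAvoidSum_pairSizes_eq`, file `…SecondMomentEps`) one matching ("colour") of
Sly's random bipartite core contributes to `E[Z²]/(EZ)²`, at overlaps `(g, h)`, the factor
`ρ = B₀ · Σ_e t(e)` with `t(e) = C(F₀-g,e) C(A,P-e) C(N-b-g-e,P)` (`slyT`) and the prefactor
`B₀ = C(F₀,g) C(N,a)² / (C(N,g) C(N-g,P) C(N-a,P) C(N-b,a)²)` (`slyB0`). With the colour rate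
`G = Ψ₂ - 2Ψ₁` (`slyGrate`, from `slyFB`, `slyPsi1` of file `…MWWRate`):

* `entB_mul`, `slyColour_entropy_eq` — the signed entropy forms of the eleven binomials of `B₀ t(e)`
  add up to `N · G(a/N, b/N, g/N, h/N, e/N)` exactly;
* `slyB0_mul_slyT_le` — **`B₀ t(e) ≤ exp(N G(c_e) + 5((log N)/2 + 2))`** everywhere (entropy bound
  for the numerators, crude Stirling for the denominators; file `LogChooseStirling`);
* `log_slyB0_mul_slyT_interior` — in the interior, the two-sided Stirling form
  `log(B₀ t(e)) = N G(c_e) + (Pref_B(c_e) - log(2πN))/2 + Θ`, `|Θ| ≤ 11/(6μ)` (`slyPrefB`).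

## References
* [Sly2010] A. Sly, *Computational transition at the uniqueness threshold*, FOCS 2010 /
  arXiv:1005.5584, §3.2 (proof of Lemma 3.5).
* [MosselWeitzWormald2008] E. Mossel, D. Weitz, N. Wormald, PTRF 143 (2009), §5 and proof of
  Theorem 6.11.
-/

namespace Literature.Computability.Complexity

open Real Finset Literature.Analysis.SpecialFunctions

section Defs

/-- **The inner term** `t(e) = C(F₀-g, e) C(A, P-e) C(N-b-g-e, P)` of one colour's two-rectangle count
in the ε-form (`pairAvoidSum_pairSizes_eq`): `P = a-g`, `A = b-h`, `F₀ = N-2b+h`.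
[cite: Sly2010, proof of Lemma 3.5, eq. (e:gt2Moment)] -/
noncomputable def slyT (N a b g h e : ℕ) : ℝ :=
  ((N - (b + b - h) - g).choose e : ℝ) * ((b - h).choose (a - g - e) : ℝ) *
    ((N - b - g - e).choose (a - g) : ℝ)

/-- **The colour prefactor** `B₀ = C(F₀,g) C(N,a)² / (C(N,g) C(N-g,P) C(N-a,P) C(N-b,a)²)`, so that the
colour's contribution to `E[Z²]/(EZ)²` at overlaps `(g,h)` is `B₀ Σ_e t(e)`.
[cite: Sly2010, proof of Lemma 3.5; MosselWeitzWormald2008, §5] -/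
noncomputable def slyB0 (N a b g h : ℕ) : ℝ :=
  ((N - (b + b - h)).choose g : ℝ) * (N.choose a : ℝ) ^ 2 /
    ((N.choose g : ℝ) * ((N - g).choose (a - g) : ℝ) * ((N - a).choose (a - g) : ℝ) *
      ((N - b).choose a : ℝ) ^ 2)

/-- **The colour rate** `G = Ψ₂ - 2Ψ₁` (one matching's second-moment rate minus twice its
first-moment rate). [cite: MosselWeitzWormald2008, §5] -/
noncomputable def slyGrate (α β γ δ ε : ℝ) : ℝ := slyFB α β γ δ ε - 2 * slyPsi1 α β

/-- **The colour prefactor exponent**: the signed sum of `log X - log Y - log(X-Y)` over the eleven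
binomials `C(XN, YN)` of `B₀ t(e)` (Stirling's `√(X/(2πN Y(X-Y)))`). [folklore] -/
noncomputable def slyPrefB (α β γ δ ε : ℝ) : ℝ :=
  (Real.log (1 - 2 * β + δ) - Real.log γ - Real.log (1 - 2 * β + δ - γ)) +
    (Real.log (1 - 2 * β + δ - γ) - Real.log ε - Real.log (1 - 2 * β + δ - γ - ε)) +
    (Real.log (β - δ) - Real.log (α - γ - ε) - Real.log (β - δ - (α - γ - ε))) +
    (Real.log (1 - β - γ - ε) - Real.log (α - γ) - Real.log (1 - β - γ - ε - (α - γ))) +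
    2 * (Real.log 1 - Real.log α - Real.log (1 - α)) -
    (Real.log 1 - Real.log γ - Real.log (1 - γ)) -
    (Real.log (1 - γ) - Real.log (α - γ) - Real.log (1 - γ - (α - γ))) -
    (Real.log (1 - α) - Real.log (α - γ) - Real.log (1 - α - (α - γ))) -
    2 * (Real.log (1 - β) - Real.log α - Real.log (1 - β - α))

end Defs

section Entropy

/-- **Scaling of the entropy form**: `entB (N X) (N Y) = N · entB X Y` for `N > 0`. [folklore] -/
theorem entB_mul {N : ℝ} (hN : 0 < N) (X Y : ℝ) : entB (N * X) (N * Y) = N * entB X Y := by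
  have hN0 : N ≠ 0 := hN.ne'
  have key : ∀ u : ℝ, N * u * Real.log (N * u) = N * (u * Real.log u) + N * u * Real.log N := by
    intro u
    by_cases hu : u = 0
    · simp [hu]
    · rw [Real.log_mul hN0 hu]; ring
  unfold entB
  rw [← mul_sub, key X, key Y, key (X - Y)]
  ring

/-- `log C(m,k) ≤ entB m k` for `k ≤ m`. [folklore] -/
theorem log_choose_le_entB {m k : ℕ} (hkm : k ≤ m) :
    Real.log (m.choose k) ≤ entB (m : ℝ) (k : ℝ) := by
  unfold entB; exact log_choose_le_entropy hkm

/-- `entB m k - (log m)/2 - 2 ≤ log C(m,k)` for `k ≤ m`, `1 ≤ m`. [folklore] -/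
theorem entB_sub_le_log_choose {m k : ℕ} (hm : 1 ≤ m) (hkm : k ≤ m) :
    entB (m : ℝ) (k : ℝ) - Real.log m / 2 - 2 ≤ Real.log (m.choose k) := by
  unfold entB; exact log_choose_ge_entropy hm hkm

end Entropy

section Upper

variable {N a b g h e : ℕ}

/-- **The entropy identity of a colour**: the signed sum of the entropy forms of the eleven binomials
of `B₀ t(e)` is `N · G(a/N, b/N, g/N, h/N, e/N)`. [cite: MosselWeitzWormald2008, §5 (the three events of `Ψ₂`)] -/
theorem slyColour_entropy_eq (hN : 0 < N) (hga : g ≤ a) (hhb : h ≤ b)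
    (hbN : b + b - h ≤ N) (habN : a + b ≤ N) (he : e ≤ a - g)
    (hgF : g + e ≤ N - (b + b - h)) :
    entB ((N - (b + b - h) : ℕ) : ℝ) g + entB ((N - (b + b - h) - g : ℕ) : ℝ) e +
          entB ((b - h : ℕ) : ℝ) ((a - g - e : ℕ) : ℝ) + entB ((N - b - g - e : ℕ) : ℝ) ((a - g : ℕ) : ℝ) +
        2 * entB (N : ℝ) a -
      (entB (N : ℝ) g + entB ((N - g : ℕ) : ℝ) ((a - g : ℕ) : ℝ) +
          entB ((N - a : ℕ) : ℝ) ((a - g : ℕ) : ℝ) + 2 * entB ((N - b : ℕ) : ℝ) a) =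
      N * slyGrate (a / N) (b / N) (g / N) (h / N) (e / N) := by
  have hNR : (0 : ℝ) < N := by exact_mod_cast hN
  have hN0 : (N : ℝ) ≠ 0 := hNR.ne'
  -- the integer arguments as `N ·` densities
  have c1 : ((N - (b + b - h) : ℕ) : ℝ) = N * (1 - 2 * (b / N) + h / N) := by
    rw [Nat.cast_sub hbN, Nat.cast_sub (by omega : h ≤ b + b)]; push_cast; field_simp; ring
  have c2 : ((N - (b + b - h) - g : ℕ) : ℝ) = N * (1 - 2 * (b / N) + h / N - g / N) := by
    rw [Nat.cast_sub (by omega : g ≤ N - (b + b - h)), Nat.cast_sub hbN,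
      Nat.cast_sub (by omega : h ≤ b + b)]; push_cast; field_simp; ring
  have c3 : ((b - h : ℕ) : ℝ) = N * (b / N - h / N) := by
    rw [Nat.cast_sub hhb]; field_simp
  have c4 : ((a - g - e : ℕ) : ℝ) = N * (a / N - g / N - e / N) := by
    rw [Nat.cast_sub he, Nat.cast_sub hga]; field_simp
  have c5 : ((N - b - g - e : ℕ) : ℝ) = N * (1 - b / N - g / N - e / N) := by
    rw [Nat.cast_sub (by omega : e ≤ N - b - g), Nat.cast_sub (by omega : g ≤ N - b),
      Nat.cast_sub (by omega : b ≤ N)]; field_simp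
  have c6 : ((a - g : ℕ) : ℝ) = N * (a / N - g / N) := by
    rw [Nat.cast_sub hga]; field_simp
  have c7 : ((N - g : ℕ) : ℝ) = N * (1 - g / N) := by
    rw [Nat.cast_sub (by omega : g ≤ N)]; field_simp
  have c8 : ((N - a : ℕ) : ℝ) = N * (1 - a / N) := by
    rw [Nat.cast_sub (by omega : a ≤ N)]; field_simp
  have c9 : ((N - b : ℕ) : ℝ) = N * (1 - b / N) := by
    rw [Nat.cast_sub (by omega : b ≤ N)]; field_simp
  have cg : (g : ℝ) = N * (g / N) := by field_simp
  have ce : (e : ℝ) = N * (e / N) := by field_simp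
  have ca : (a : ℝ) = N * (a / N) := by field_simp
  have E1 : entB ((N - (b + b - h) : ℕ) : ℝ) g = N * entB (1 - 2 * (b / N) + h / N) (g / N) := by
    conv_lhs => rw [c1, cg]
    exact entB_mul hNR _ _
  have E2 : entB ((N - (b + b - h) - g : ℕ) : ℝ) e =
      N * entB (1 - 2 * (b / N) + h / N - g / N) (e / N) := by
    conv_lhs => rw [c2, ce]
    exact entB_mul hNR _ _
  have E3 : entB ((b - h : ℕ) : ℝ) ((a - g - e : ℕ) : ℝ) =
      N * entB (b / N - h / N) (a / N - g / N - e / N) := by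
    rw [c3, c4]; exact entB_mul hNR _ _
  have E4 : entB ((N - b - g - e : ℕ) : ℝ) ((a - g : ℕ) : ℝ) =
      N * entB (1 - b / N - g / N - e / N) (a / N - g / N) := by
    rw [c5, c6]; exact entB_mul hNR _ _
  have E5 : entB (N : ℝ) a = N * entB 1 (a / N) := by
    rw [← entB_mul hNR, mul_one]; congr 1
  have E7 : entB (N : ℝ) g = N * entB 1 (g / N) := by
    rw [← entB_mul hNR, mul_one]; congr 1
  have E8 : entB ((N - g : ℕ) : ℝ) ((a - g : ℕ) : ℝ) = N * entB (1 - g / N) (a / N - g / N) := by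
    rw [c7, c6]; exact entB_mul hNR _ _
  have E9 : entB ((N - a : ℕ) : ℝ) ((a - g : ℕ) : ℝ) = N * entB (1 - a / N) (a / N - g / N) := by
    rw [c8, c6]; exact entB_mul hNR _ _
  have E10 : entB ((N - b : ℕ) : ℝ) a = N * entB (1 - b / N) (a / N) := by
    conv_lhs => rw [c9, ca]
    exact entB_mul hNR _ _
  rw [E1, E2, E3, E4, E5, E7, E8, E9, E10]
  unfold slyGrate slyFB slyPsi1
  ring

/-- **Upper bound for a colour term, everywhere**: `B₀ t(e) ≤ exp(N G(c_e) + 5((log N)/2 + 2))`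
(entropy bounds for the numerators, crude Stirling lower bounds for the denominators).
[cite: Sly2010, proof of Lemma 3.5] -/
theorem slyB0_mul_slyT_le (hN : 1 ≤ N) (hga : g ≤ a) (hhb : h ≤ b)
    (hbN : b + b - h ≤ N) (habN : a + b < N) (he : e ≤ a - g) :
    slyB0 N a b g h * slyT N a b g h e ≤
      Real.exp (N * slyGrate (a / N) (b / N) (g / N) (h / N) (e / N) +
        5 * (Real.log N / 2 + 2)) := by
  have hNpos : 0 < N := hN
  -- degenerate cases: a vanishing numerator binomial
  by_cases hPe : a - g - e ≤ b - h
  swap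
  · have : ((b - h).choose (a - g - e) : ℝ) = 0 := by
      exact_mod_cast Nat.choose_eq_zero_of_lt (by omega)
    have ht : slyT N a b g h e = 0 := by unfold slyT; rw [this]; ring
    rw [ht, mul_zero]; exact (Real.exp_pos _).le
  by_cases hgF : g + e ≤ N - (b + b - h)
  swap
  · by_cases hg0 : g ≤ N - (b + b - h)
    · have : ((N - (b + b - h) - g).choose e : ℝ) = 0 := by
        exact_mod_cast Nat.choose_eq_zero_of_lt (by omega)
      have ht : slyT N a b g h e = 0 := by unfold slyT; rw [this]; ring
      rw [ht, mul_zero]; exact (Real.exp_pos _).le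
    · have : ((N - (b + b - h)).choose g : ℝ) = 0 := by
        exact_mod_cast Nat.choose_eq_zero_of_lt (by omega)
      have hb : slyB0 N a b g h = 0 := by unfold slyB0; rw [this]; ring
      rw [hb, zero_mul]; exact (Real.exp_pos _).le
  by_cases hPT : a - g ≤ N - b - g - e
  swap
  · have : ((N - b - g - e).choose (a - g) : ℝ) = 0 := by
      exact_mod_cast Nat.choose_eq_zero_of_lt (by omega)
    have ht : slyT N a b g h e = 0 := by unfold slyT; rw [this]; ring
    rw [ht, mul_zero]; exact (Real.exp_pos _).le
  -- all eleven binomials are positive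
  have p1 : 0 < ((N - (b + b - h)).choose g : ℝ) := by exact_mod_cast Nat.choose_pos (by omega)
  have p2 : 0 < ((N - (b + b - h) - g).choose e : ℝ) := by exact_mod_cast Nat.choose_pos (by omega)
  have p3 : 0 < ((b - h).choose (a - g - e) : ℝ) := by exact_mod_cast Nat.choose_pos hPe
  have p4 : 0 < ((N - b - g - e).choose (a - g) : ℝ) := by exact_mod_cast Nat.choose_pos hPT
  have p5 : 0 < (N.choose a : ℝ) := by exact_mod_cast Nat.choose_pos (by omega)
  have p7 : 0 < (N.choose g : ℝ) := by exact_mod_cast Nat.choose_pos (by omega)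
  have p8 : 0 < ((N - g).choose (a - g) : ℝ) := by exact_mod_cast Nat.choose_pos (by omega)
  have p9 : 0 < ((N - a).choose (a - g) : ℝ) := by exact_mod_cast Nat.choose_pos (by omega)
  have p10 : 0 < ((N - b).choose a : ℝ) := by exact_mod_cast Nat.choose_pos (by omega)
  have hpos : 0 < slyB0 N a b g h * slyT N a b g h e := by
    unfold slyB0 slyT; positivity
  rw [← Real.exp_log hpos, Real.exp_le_exp]
  have hlog : Real.log (slyB0 N a b g h * slyT N a b g h e) =
      (Real.log ((N - (b + b - h)).choose g) + 2 * Real.log (N.choose a) -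
        (Real.log (N.choose g) + Real.log ((N - g).choose (a - g)) +
          Real.log ((N - a).choose (a - g)) + 2 * Real.log ((N - b).choose a))) +
      (Real.log ((N - (b + b - h) - g).choose e) + Real.log ((b - h).choose (a - g - e)) +
        Real.log ((N - b - g - e).choose (a - g))) := by
    unfold slyB0 slyT
    rw [Real.log_mul (by positivity) (by positivity), Real.log_div (by positivity) (by positivity),
      Real.log_mul p1.ne' (by positivity), Real.log_pow,
      Real.log_mul (by positivity) (by positivity), Real.log_pow,
      Real.log_mul (by positivity) p9.ne', Real.log_mul p7.ne' p8.ne',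
      Real.log_mul (by positivity) p4.ne', Real.log_mul p2.ne' p3.ne']
    push_cast
    ring
  rw [hlog]
  -- entropy bounds
  have u1 := log_choose_le_entB (m := N - (b + b - h)) (k := g) (by omega)
  have u2 := log_choose_le_entB (m := N - (b + b - h) - g) (k := e) (by omega)
  have u3 := log_choose_le_entB hPe
  have u4 := log_choose_le_entB hPT
  have u5 := log_choose_le_entB (m := N) (k := a) (by omega)
  have l7 := entB_sub_le_log_choose (m := N) (k := g) hN (by omega)
  have l8 := entB_sub_le_log_choose (m := N - g) (k := a - g) (by omega) (by omega)
  have l9 := entB_sub_le_log_choose (m := N - a) (k := a - g) (by omega) (by omega)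
  have l10 := entB_sub_le_log_choose (m := N - b) (k := a) (by omega) (by omega)
  have hid := slyColour_entropy_eq hNpos hga hhb hbN habN.le he hgF
  -- `log m ≤ log N` for the denominators
  have hNR : (1 : ℝ) ≤ N := by exact_mod_cast hN
  have m8 : Real.log ((N - g : ℕ) : ℝ) ≤ Real.log N :=
    Real.log_le_log (by exact_mod_cast (by omega : 0 < N - g)) (by exact_mod_cast Nat.sub_le N g)
  have m9 : Real.log ((N - a : ℕ) : ℝ) ≤ Real.log N :=
    Real.log_le_log (by exact_mod_cast (by omega : 0 < N - a)) (by exact_mod_cast Nat.sub_le N a)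
  have m10 : Real.log ((N - b : ℕ) : ℝ) ≤ Real.log N :=
    Real.log_le_log (by exact_mod_cast (by omega : 0 < N - b)) (by exact_mod_cast Nat.sub_le N b)
  have hlogN : 0 ≤ Real.log N := Real.log_nonneg hNR
  linarith

end Upper

section Interior

variable {N a b g h e : ℕ}

/-- `log (N X) - log (N Y) - log (N X - N Y) = log X - log Y - log (X - Y) - log N` for positive
arguments. [folklore] -/
theorem log_pref_scaled {N X Y : ℝ} (hN : 0 < N) (hX : 0 < X) (hY : 0 < Y) (hXY : Y < X) :
    Real.log (N * X) - Real.log (N * Y) - Real.log (N * X - N * Y) =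
      Real.log X - Real.log Y - Real.log (X - Y) - Real.log N := by
  rw [← mul_sub, Real.log_mul hN.ne' hX.ne', Real.log_mul hN.ne' hY.ne',
    Real.log_mul hN.ne' (by linarith : X - Y ≠ 0)]
  ring

set_option maxHeartbeats 1600000 in
/-- **Two-sided Stirling form of a colour term in the interior**: when all eleven binomials of
`B₀ t(e)` are non-degenerate,
`log(B₀ t(e)) = N G(c_e) + (Pref_B(c_e) - log(2πN))/2 + Θ`, `|Θ| ≤ 11/(6μ)`, where `μ` is a lower
bound for all the lower indices and their complements. [cite: Sly2010, proof of Lemma 3.5; MosselWeitzWormald2008, proof of Theorem 6.11] -/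
theorem log_slyB0_mul_slyT_interior (hga : g ≤ a) (hhb : h ≤ b) (hbN : b + b - h ≤ N)
    (habN : a + b < N) (he : e ≤ a - g) {μ : ℕ} (hμ : 1 ≤ μ)
    (k1 : μ ≤ g) (k1' : g + μ ≤ N - (b + b - h))
    (k2 : μ ≤ e) (k2' : e + μ ≤ N - (b + b - h) - g)
    (k3 : μ ≤ a - g - e) (k3' : a - g - e + μ ≤ b - h)
    (k4 : μ ≤ a - g) (k4' : a - g + μ ≤ N - b - g - e)
    (k5 : μ ≤ a) (k9' : a - g + μ ≤ N - a) (k10' : a + μ ≤ N - b) :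
    |Real.log (slyB0 N a b g h * slyT N a b g h e) -
        (N * slyGrate (a / N) (b / N) (g / N) (h / N) (e / N) +
          (slyPrefB (a / N) (b / N) (g / N) (h / N) (e / N) - Real.log (2 * π * N)) / 2)| ≤
      11 / (6 * (μ : ℝ)) := by
  have hN : 0 < N := by omega
  have hNR : (0 : ℝ) < N := by exact_mod_cast hN
  have hμR : (1 : ℝ) ≤ μ := by exact_mod_cast hμ
  -- the eleven Stirling forms
  obtain ⟨θ1, l1, u1, e1⟩ := log_choose_eq_stirling (m := N - (b + b - h)) (k := g) (by omega) (by omega)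
  obtain ⟨θ2, l2, u2, e2⟩ := log_choose_eq_stirling (m := N - (b + b - h) - g) (k := e) (by omega) (by omega)
  obtain ⟨θ3, l3, u3, e3⟩ := log_choose_eq_stirling (m := b - h) (k := a - g - e) (by omega) (by omega)
  obtain ⟨θ4, l4, u4, e4⟩ := log_choose_eq_stirling (m := N - b - g - e) (k := a - g) (by omega) (by omega)
  obtain ⟨θ5, l5, u5, e5⟩ := log_choose_eq_stirling (m := N) (k := a) (by omega) (by omega)
  obtain ⟨θ7, l7, u7, e7⟩ := log_choose_eq_stirling (m := N) (k := g) (by omega) (by omega)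
  obtain ⟨θ8, l8, u8, e8⟩ := log_choose_eq_stirling (m := N - g) (k := a - g) (by omega) (by omega)
  obtain ⟨θ9, l9, u9, e9⟩ := log_choose_eq_stirling (m := N - a) (k := a - g) (by omega) (by omega)
  obtain ⟨θ10, l10, u10, e10⟩ := log_choose_eq_stirling (m := N - b) (k := a) (by omega) (by omega)
  -- positivity of the binomials and the logarithm of the product
  have p1 : 0 < ((N - (b + b - h)).choose g : ℝ) := by exact_mod_cast Nat.choose_pos (by omega)
  have p2 : 0 < ((N - (b + b - h) - g).choose e : ℝ) := by exact_mod_cast Nat.choose_pos (by omega)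
  have p3 : 0 < ((b - h).choose (a - g - e) : ℝ) := by exact_mod_cast Nat.choose_pos (by omega)
  have p4 : 0 < ((N - b - g - e).choose (a - g) : ℝ) := by exact_mod_cast Nat.choose_pos (by omega)
  have p5 : 0 < (N.choose a : ℝ) := by exact_mod_cast Nat.choose_pos (by omega)
  have p7 : 0 < (N.choose g : ℝ) := by exact_mod_cast Nat.choose_pos (by omega)
  have p8 : 0 < ((N - g).choose (a - g) : ℝ) := by exact_mod_cast Nat.choose_pos (by omega)
  have p9 : 0 < ((N - a).choose (a - g) : ℝ) := by exact_mod_cast Nat.choose_pos (by omega)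
  have p10 : 0 < ((N - b).choose a : ℝ) := by exact_mod_cast Nat.choose_pos (by omega)
  have hlog : Real.log (slyB0 N a b g h * slyT N a b g h e) =
      (Real.log ((N - (b + b - h)).choose g) + 2 * Real.log (N.choose a) -
        (Real.log (N.choose g) + Real.log ((N - g).choose (a - g)) +
          Real.log ((N - a).choose (a - g)) + 2 * Real.log ((N - b).choose a))) +
      (Real.log ((N - (b + b - h) - g).choose e) + Real.log ((b - h).choose (a - g - e)) +
        Real.log ((N - b - g - e).choose (a - g))) := by
    unfold slyB0 slyT
    rw [Real.log_mul (by positivity) (by positivity), Real.log_div (by positivity) (by positivity),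
      Real.log_mul p1.ne' (by positivity), Real.log_pow,
      Real.log_mul (by positivity) (by positivity), Real.log_pow,
      Real.log_mul (by positivity) p9.ne', Real.log_mul p7.ne' p8.ne',
      Real.log_mul (by positivity) p4.ne', Real.log_mul p2.ne' p3.ne']
    push_cast
    ring
  -- the entropy identity
  have hid := slyColour_entropy_eq hN hga hhb hbN habN.le he (by omega)
  -- the prefactors in density form
  have c1 : ((N - (b + b - h) : ℕ) : ℝ) = N * (1 - 2 * (b / N) + h / N) := by
    rw [Nat.cast_sub hbN, Nat.cast_sub (by omega : h ≤ b + b)]; push_cast; field_simp; ring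
  have c2 : ((N - (b + b - h) - g : ℕ) : ℝ) = N * (1 - 2 * (b / N) + h / N - g / N) := by
    rw [Nat.cast_sub (by omega : g ≤ N - (b + b - h)), Nat.cast_sub hbN,
      Nat.cast_sub (by omega : h ≤ b + b)]; push_cast; field_simp; ring
  have c3 : ((b - h : ℕ) : ℝ) = N * (b / N - h / N) := by
    rw [Nat.cast_sub hhb]; field_simp
  have c4 : ((a - g - e : ℕ) : ℝ) = N * (a / N - g / N - e / N) := by
    rw [Nat.cast_sub he, Nat.cast_sub hga]; field_simp
  have c5 : ((N - b - g - e : ℕ) : ℝ) = N * (1 - b / N - g / N - e / N) := by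
    rw [Nat.cast_sub (by omega : e ≤ N - b - g), Nat.cast_sub (by omega : g ≤ N - b),
      Nat.cast_sub (by omega : b ≤ N)]; field_simp
  have c6 : ((a - g : ℕ) : ℝ) = N * (a / N - g / N) := by
    rw [Nat.cast_sub hga]; field_simp
  have c7 : ((N - g : ℕ) : ℝ) = N * (1 - g / N) := by
    rw [Nat.cast_sub (by omega : g ≤ N)]; field_simp
  have c8 : ((N - a : ℕ) : ℝ) = N * (1 - a / N) := by
    rw [Nat.cast_sub (by omega : a ≤ N)]; field_simp
  have c9 : ((N - b : ℕ) : ℝ) = N * (1 - b / N) := by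
    rw [Nat.cast_sub (by omega : b ≤ N)]; field_simp
  have cg : (g : ℝ) = N * (g / N) := by field_simp
  have ce : (e : ℝ) = N * (e / N) := by field_simp
  have ca : (a : ℝ) = N * (a / N) := by field_simp
  have cN : (N : ℝ) = N * 1 := by ring
  -- positivity of the densities
  have d1 : (0 : ℝ) < g / N := by
    have : (0 : ℝ) < g := by exact_mod_cast (by omega : 0 < g)
    positivity
  have d2 : (0 : ℝ) < e / N := by
    have : (0 : ℝ) < e := by exact_mod_cast (by omega : 0 < e)
    positivity
  have d3 : (0 : ℝ) < a / N := by
    have : (0 : ℝ) < a := by exact_mod_cast (by omega : 0 < a)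
    positivity
  have dX1 : g / (N : ℝ) < 1 - 2 * (b / N) + h / N := by
    have : (N : ℝ) * (g / N) < N * (1 - 2 * (b / N) + h / N) := by
      rw [← cg, ← c1]; exact_mod_cast (by omega : g < N - (b + b - h))
    exact lt_of_mul_lt_mul_left this hNR.le
  have dX2 : e / (N : ℝ) < 1 - 2 * (b / N) + h / N - g / N := by
    have : (N : ℝ) * (e / N) < N * (1 - 2 * (b / N) + h / N - g / N) := by
      rw [← ce, ← c2]; exact_mod_cast (by omega : e < N - (b + b - h) - g)
    exact lt_of_mul_lt_mul_left this hNR.le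
  have dY3 : (0 : ℝ) < a / N - g / N - e / N := by
    have : (N : ℝ) * 0 < N * (a / N - g / N - e / N) := by
      rw [← c4, mul_zero]; exact_mod_cast (by omega : 0 < a - g - e)
    exact lt_of_mul_lt_mul_left this hNR.le
  have dX3 : a / (N : ℝ) - g / N - e / N < b / N - h / N := by
    have : (N : ℝ) * (a / N - g / N - e / N) < N * (b / N - h / N) := by
      rw [← c4, ← c3]; exact_mod_cast (by omega : a - g - e < b - h)
    exact lt_of_mul_lt_mul_left this hNR.le
  have dY4 : (0 : ℝ) < a / N - g / N := by
    have : (N : ℝ) * 0 < N * (a / N - g / N) := by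
      rw [← c6, mul_zero]; exact_mod_cast (by omega : 0 < a - g)
    exact lt_of_mul_lt_mul_left this hNR.le
  have dX4 : a / (N : ℝ) - g / N < 1 - b / N - g / N - e / N := by
    have : (N : ℝ) * (a / N - g / N) < N * (1 - b / N - g / N - e / N) := by
      rw [← c6, ← c5]; exact_mod_cast (by omega : a - g < N - b - g - e)
    exact lt_of_mul_lt_mul_left this hNR.le
  have dX5 : a / (N : ℝ) < 1 := by
    rw [div_lt_one hNR]; exact_mod_cast (by omega : a < N)
  have dX7 : g / (N : ℝ) < 1 := by
    rw [div_lt_one hNR]; exact_mod_cast (by omega : g < N)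
  have dX8 : a / (N : ℝ) - g / N < 1 - g / N := by linarith
  have dX9 : a / (N : ℝ) - g / N < 1 - a / N := by
    have : (N : ℝ) * (a / N - g / N) < N * (1 - a / N) := by
      rw [← c6, ← c8]; exact_mod_cast (by omega : a - g < N - a)
    exact lt_of_mul_lt_mul_left this hNR.le
  have dX10 : a / (N : ℝ) < 1 - b / N := by
    have : (N : ℝ) * (a / N) < N * (1 - b / N) := by
      rw [← ca, ← c9]; exact_mod_cast (by omega : a < N - b)
    exact lt_of_mul_lt_mul_left this hNR.le
  -- the eleven prefactor identities
  have P1 := log_pref_scaled hNR (by linarith) d1 dX1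
  have P2 := log_pref_scaled hNR (by linarith) d2 dX2
  have P3 := log_pref_scaled hNR (by linarith) dY3 dX3
  have P4 := log_pref_scaled hNR (by linarith) dY4 dX4
  have P5 := log_pref_scaled hNR one_pos d3 dX5
  have P7 := log_pref_scaled hNR one_pos d1 dX7
  have P8 := log_pref_scaled hNR (by linarith) dY4 dX8
  have P9 := log_pref_scaled hNR (by linarith) dY4 dX9
  have P10 := log_pref_scaled hNR (by linarith) d3 dX10
  rw [← c1, ← cg] at P1
  rw [← c2, ← ce] at P2
  rw [← c3, ← c4] at P3
  rw [← c5, ← c6] at P4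
  rw [mul_one, ← ca] at P5
  rw [mul_one, ← cg] at P7
  rw [← c7, ← c6] at P8
  rw [← c8, ← c6] at P9
  rw [← c9, ← ca] at P10
  have h2π : Real.log (2 * π * N) = Real.log (2 * π) + Real.log N :=
    Real.log_mul (by positivity) hNR.ne'
  -- the error bound
  have hμk : ∀ {k : ℕ}, μ ≤ k → 1 / (12 * (k : ℝ)) ≤ 1 / (12 * (μ : ℝ)) := by
    intro k hk
    exact one_div_le_one_div_of_le (by positivity) (by
      have : (μ : ℝ) ≤ k := by exact_mod_cast hk
      linarith)
  have hμk' : ∀ {m k : ℕ}, k + μ ≤ m → 1 / (12 * ((m : ℝ) - k)) ≤ 1 / (12 * (μ : ℝ)) := by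
    intro m k hk
    exact one_div_le_one_div_of_le (by positivity) (by
      have : ((k : ℝ) + μ) ≤ m := by exact_mod_cast hk
      linarith)
  have hμm : ∀ {m : ℕ}, μ ≤ m → 1 / (12 * (m : ℝ)) ≤ 1 / (12 * (μ : ℝ)) := fun hm => hμk hm
  have b1 := hμk k1; have b1' := hμk' k1'; have b1m := hμm (m := N - (b + b - h)) (by omega)
  have b2 := hμk k2; have b2' := hμk' k2'; have b2m := hμm (m := N - (b + b - h) - g) (by omega)
  have b3 := hμk k3; have b3' := hμk' k3'; have b3m := hμm (m := b - h) (by omega)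
  have b4 := hμk k4; have b4' := hμk' k4'; have b4m := hμm (m := N - b - g - e) (by omega)
  have b5 := hμk k5; have b5' := hμk' (m := N) (k := a) (by omega); have b5m := hμm (m := N) (by omega)
  have b7 := hμk k1; have b7' := hμk' (m := N) (k := g) (by omega)
  have b8 := hμk k4; have b8' := hμk' (m := N - g) (k := a - g) (by omega)
  have b8m := hμm (m := N - g) (by omega)
  have b9' := hμk' k9'; have b9m := hμm (m := N - a) (by omega)
  have b10' := hμk' k10'; have b10m := hμm (m := N - b) (by omega)
  have hΘ : Real.log (slyB0 N a b g h * slyT N a b g h e) -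
      (N * slyGrate (a / N) (b / N) (g / N) (h / N) (e / N) +
        (slyPrefB (a / N) (b / N) (g / N) (h / N) (e / N) - Real.log (2 * π * N)) / 2) =
      θ1 + θ2 + θ3 + θ4 + 2 * θ5 - θ7 - θ8 - θ9 - 2 * θ10 := by
    rw [hlog, ← hid, h2π]
    unfold slyPrefB entB
    simp only [Real.log_one] at P5 P7 ⊢
    linear_combination (e1 + e2 + e3 + e4 + 2 * e5 - e7 - e8 - e9 - 2 * e10) +
      (1 / 2 : ℝ) * (P1 + P2 + P3 + P4 + 2 * P5 - P7 - P8 - P9 - 2 * P10)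
  have hconv : (11 : ℝ) / (6 * (μ : ℝ)) = 22 * (1 / (12 * (μ : ℝ))) := by
    field_simp; ring
  have ht : (0 : ℝ) ≤ 1 / (12 * (μ : ℝ)) := by positivity
  rw [hΘ, hconv, abs_le]
  constructor
  · linarith only [l1, l2, l3, l4, l5, u7, u8, u9, u10, b1, b1', b2, b2', b3, b3', b4, b4', b5, b5',
      b5m, b8m, b9m, b10m, ht]
  · linarith only [u1, u2, u3, u4, u5, l7, l8, l9, l10, b1m, b2m, b3m, b4m, b5m, b7, b7', b8, b8',
      b9', b10', b4, b5, ht]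

end Interior

end Literature.Computability.Complexity
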